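import Mathlib
import Summits.Ventures.HodgeRepro.Tier4.Common.KTypeSpace
import Summits.Ventures.HodgeRepro.Tier4.Common.SettingOfData
import Summits.Ventures.HodgeRepro.Tier4.Common.KTypeProjector
import Summits.Ventures.HodgeRepro.Tier4.Line4.W4SpectralBridge

/-!
# Tier4/Line4/KTypeOfPeriodPrimed — the primed twin of `KTypeOfPeriod`: a non-zero `T′`-period forces the `K`-type of
the TRANSPORTED torus (C-L4-KTYPE, primed)

Blind re-derivation cell `pub-hodge-repro`, Tier 4 «prove the step» (README §9–§10), seat t4-L4-p1 (prover, LINE L4,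
gen 3; plan-4's cut C-L4-KTYPE S14010).  Tree path `lean/Summits/Ventures/HodgeRepro/Tier4/Line4/KTypeOfPeriodPrimed.lean`.
The text of `KTypeOfPeriod` with `T ↦ T′` (`torusT' W`, `localTorusAt' W w`, `weightAt' W q w g g'`, `ChiMatchesAt'`,
`R.chi'`, `R.μT'`, `R.DT'`, `HasKTypeAt'`); the same displayed hypotheses (α)–(δ).

Nothing here says anything about the status of the Hodge conjecture for CM abelian varieties, which is NOT proved
(HC_CM is NOT proved by anyone in this repository).
-/

set_option autoImplicit false

noncomputable section

namespace Summit.Ventures.HodgeRepro.Tier4.Line4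

open Summit.Ventures.HodgeRepro.Tier4.Common Summit.Ventures.HodgeRepro.Tier4.Line1 MeasureTheory NumberField
open scoped ComplexConjugate

section TorusTranslate'

variable {k : Type} [Field k] [NumberField k] (W : PlaneData k) [MeasurableSpace (GA W)] [BorelSpace (GA W)]
  (R : RTFData W) [R.μT'.IsHaarMeasure] [R.μT'.IsMulRightInvariant]

omit [R.μT'.IsHaarMeasure] in
/-- The right translate `D_T · κ` of the torus fundamental domain is a fundamental domain of the rational torus. -/
theorem isFundamentalDomain_DT'_mul_right (κ : torusT' W) :
    IsFundamentalDomain (rationalOf W (torusT' W)) ((fun t => t * κ) '' R.DT') R.μT' := by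
  have h := R.DT'_fund.image_of_equiv (Equiv.mulRight κ)
    (measurePreserving_mul_right R.μT' κ⁻¹).quasiMeasurePreserving (Equiv.refl _) (fun γ x => by
      simp only [Equiv.refl_apply, Equiv.coe_mulRight, Subgroup.smul_def, smul_eq_mul]
      group)
  simpa using h

omit [R.μT'.IsHaarMeasure] in
/-- Right translation of the torus set integral: `∫_{D_T} H(t κ) = ∫_{D_T · κ} H`. -/
theorem setIntegral_DT'_mul_right (H : torusT' W → ℂ) (κ : torusT' W) :
    ∫ t in R.DT', H (t * κ) ∂(R.μT') = ∫ t in (fun t => t * κ) '' R.DT', H t ∂(R.μT') := by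
  have hind : ∀ t, R.DT'.indicator (fun t => H (t * κ)) t = ((fun t => t * κ) '' R.DT').indicator H (t * κ) := by
    intro t
    by_cases ht : t ∈ R.DT'
    · rw [Set.indicator_of_mem ht, Set.indicator_of_mem (Set.mem_image_of_mem _ ht)]
    · rw [Set.indicator_of_notMem ht, Set.indicator_of_notMem]
      rintro ⟨y, hy, hyt⟩
      exact ht (mul_right_cancel hyt ▸ hy)
  have hnm : NullMeasurableSet ((fun t => t * κ) '' R.DT') R.μT' :=
    (isFundamentalDomain_DT'_mul_right W R κ).nullMeasurableSet
  rw [← integral_indicator₀ R.DT'_fund.nullMeasurableSet, ← integral_indicator₀ hnm,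
    ← integral_mul_right_eq_self (((fun t => t * κ) '' R.DT').indicator H) κ]
  exact integral_congr_ae (Filter.Eventually.of_forall hind)

omit [BorelSpace (GA W)] [R.μT'.IsHaarMeasure] [R.μT'.IsMulRightInvariant] in
/-- The character value at `1` is `1` (unit modulus excludes `0`). -/
theorem chi'_one_eq (hu : ∀ a, ‖R.chi' a‖ = 1) : R.chi' 1 = 1 := by
  have h := R.chi'_mul 1 1
  rw [mul_one] at h
  have hne : R.chi' 1 ≠ 0 := by
    intro h0
    have := hu 1
    rw [h0, norm_zero] at this
    exact zero_ne_one this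
  have : R.chi' 1 * (R.chi' 1 - 1) = 0 := by
    rw [mul_sub, ← h, mul_one, sub_self]
  rcases mul_eq_zero.1 this with h1 | h1
  · exact absurd h1 hne
  · exact sub_eq_zero.1 h1

omit [BorelSpace (GA W)] [R.μT'.IsHaarMeasure] [R.μT'.IsMulRightInvariant] in
/-- `χ(κ⁻¹) = χ(κ)⁻¹`. -/
theorem chi'_inv_eq (hu : ∀ a, ‖R.chi' a‖ = 1) (κ : torusT' W) : R.chi' κ⁻¹ = (R.chi' κ)⁻¹ := by
  have h := R.chi'_mul κ κ⁻¹
  rw [mul_inv_cancel, chi'_one_eq W R hu] at h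
  have hne : R.chi' κ ≠ 0 := by
    intro h0
    have := hu κ
    rw [h0, norm_zero] at this
    exact zero_ne_one this
  exact eq_inv_of_mul_eq_one_right h.symm

/-- **The torus period of a right translate**: for `f` invariant under the rational points and `χ` trivial on them,
`∫_{D_T} χ(t) f(t κ) = χ(κ)⁻¹ ∫_{D_T} χ(t) f(t)`. -/
theorem setIntegral_chi'_mul_translate (hu : ∀ a, ‖R.chi' a‖ = 1) {F : torusT' W → ℂ}
    (hF : ∀ γ : rationalOf W (torusT' W), ∀ t, F ((γ : torusT' W) * t) = F t) (κ : torusT' W) :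
    ∫ t in R.DT', R.chi' t * F (t * κ) ∂(R.μT') = (R.chi' κ)⁻¹ * ∫ t in R.DT', R.chi' t * F t ∂(R.μT') := by
  have e : (fun t => R.chi' t * F (t * κ)) = fun t => (R.chi' κ)⁻¹ * ((fun s => R.chi' s * F s) (t * κ)) := by
    funext t
    simp only
    rw [R.chi'_mul, mul_comm (R.chi' t) (R.chi' κ), mul_assoc, ← mul_assoc (R.chi' κ)⁻¹, inv_mul_cancel₀, one_mul]
    intro h0
    have := hu κ
    rw [h0, norm_zero] at this
    exact zero_ne_one this
  rw [e, integral_const_mul, setIntegral_DT'_mul_right W R (fun s => R.chi' s * F s) κ]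
  congr 1
  haveI : Countable (rationalPoints W) := rationalPoints_countable W
  haveI : Countable (rationalOf W (torusT' W)) := by
    refine Function.Injective.countable
      (f := fun γ : rationalOf W (torusT' W) =>
        (⟨((γ : torusT' W) : GA W), Subgroup.mem_subgroupOf.1 γ.2⟩ : rationalPoints W)) ?_
    intro γ γ' h
    simp only [Subtype.mk.injEq] at h
    exact Subtype.ext (Subtype.ext h)
  haveI : SMulInvariantMeasure (rationalOf W (torusT' W)) (torusT' W) R.μT' :=
    ⟨fun γ s _ => by
      show R.μT' ((fun t => (γ : torusT' W) * t) ⁻¹' s) = R.μT' s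
      exact measure_preimage_mul R.μT' (γ : torusT' W) s⟩
  refine (isFundamentalDomain_DT'_mul_right W R κ).setIntegral_eq R.DT'_fund ?_
  intro γ t
  simp only [Subgroup.smul_def, smul_eq_mul]
  rw [R.chi'_mul, R.chi'_rational _ γ.2, one_mul, hF γ t]

end TorusTranslate'

section KTypeOfPeriod'

variable {k : Type} [Field k] [NumberField k] (W : PlaneData k) [MeasurableSpace (GA W)] [BorelSpace (GA W)]
  (R : RTFData W) [R.μT'.IsHaarMeasure] [R.μT'.IsMulRightInvariant]
  (w : InfinitePlace k) (q : QuadData k) (g g' : Matrix (Fin 4) (Fin 4) k) (eP eM : InfinitePlace k → ℤ)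
  [CompactSpace (localTorusAt' W w)] (ν : Measure (localTorusAt' W w)) [IsProbabilityMeasure ν]
  [ν.IsMulLeftInvariant]

omit [ν.IsMulLeftInvariant] in
set_option synthInstance.maxHeartbeats 400000 in
/-- **The `χ`-period of the `(T_w, weight)`-projection equals the `χ`-period**: `P_χ(e_{C,χ_w} f) = P_χ(f)` for `f`
continuous and invariant under the rational points, `χ` matching the weight at `w` (`ChiMatchesAt`). -/
theorem periodLin'_kProj_eq (hu : ∀ a, ‖R.chi' a‖ = 1) (hc : Continuous R.chi') (compT : IsCompact (closure R.DT'))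
    (hχc : Continuous fun κ : localTorusAt' W w => weightAt' W q w g g' 0 κ ^ eP w * weightAt' W q w g g' 1 κ ^ eM w)
    (hu' : ∀ κ : localTorusAt' W w, ‖weightAt' W q w g g' 0 κ ^ eP w * weightAt' W q w g g' 1 κ ^ eM w‖ = 1)
    (hmatch : ChiMatchesAt' W q w g g' (eP w) (eM w) R.chi')
    {f : GA W → ℂ} (hfc : Continuous f) (hfinv : ∀ γ : rationalPoints W, ∀ x, f ((γ : GA W) * x) = f x) :
    periodLin W R.μT' R.DT' R.chi' (restrictTo W (torusT' W)
        (kProj (localTorusAt' W w) ν (fun κ => weightAt' W q w g g' 0 κ ^ eP w * weightAt' W q w g g' 1 κ ^ eM w) f)) =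
      periodLin W R.μT' R.DT' R.chi' (restrictTo W (torusT' W) f) := by
  classical
  haveI := locallyCompact_GA W
  haveI := secondCountable_GA W
  haveI : SecondCountableTopology (torusT' W) := Topology.IsInducing.subtypeVal.secondCountableTopology
  haveI : SecondCountableTopology (localTorusAt' W w) := Topology.IsInducing.subtypeVal.secondCountableTopology
  haveI : OpensMeasurableSpace (torusT' W × localTorusAt' W w) := Prod.opensMeasurableSpace
  haveI : IsFiniteMeasureOnCompacts R.μT' := (inferInstance : R.μT'.IsHaarMeasure).toIsFiniteMeasureOnCompacts
  haveI : IsFiniteMeasure (R.μT'.restrict R.DT') :=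
    isFiniteMeasure_restrict.mpr ((measure_mono subset_closure).trans_lt compT.measure_lt_top).ne
  haveI : SFinite (R.μT'.restrict R.DT') := inferInstance
  haveI : IsFiniteMeasure ν := inferInstance
  haveI : SFinite ν := inferInstance
  set χw : GA W → ℂ := fun κ => weightAt' W q w g g' 0 κ ^ eP w * weightAt' W q w g g' 1 κ ^ eM w with hχw
  set F : torusT' W → ℂ := restrictTo W (torusT' W) f with hF
  -- the projection is continuous
  have hkc : Continuous (kProj (localTorusAt' W w) ν χw f) := continuous_kProj (localTorusAt' W w) ν hχc hfc
  -- the two periods are integrals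
  have hint1 : Integrable (fun t => R.chi' t * restrictTo W (torusT' W) (kProj (localTorusAt' W w) ν χw f) t) (R.μT'.restrict R.DT') :=
    integrableOn_of_continuous_of_isCompact_closure R.μT' compT (hc.mul (hkc.comp continuous_subtype_val))
  have hint2 : Integrable (fun t => R.chi' t * F t) (R.μT'.restrict R.DT') :=
    integrableOn_of_continuous_of_isCompact_closure R.μT' compT (hc.mul (hfc.comp continuous_subtype_val))
  rw [periodLin_eq_integral W R.μT' R.DT' R.chi' hint1, periodLin_eq_integral W R.μT' R.DT' R.chi' hint2]
  -- the integrand as a function on the product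
  set Φ : torusT' W × localTorusAt' W w → ℂ := fun p => R.chi' p.1 * (conj (χw p.2) * f ((p.1 : GA W) * (p.2 : GA W))) with hΦ
  have hΦc : Continuous Φ := by
    refine hc.comp continuous_fst |>.mul ?_
    refine (Complex.continuous_conj.comp (hχc.comp continuous_snd)).mul ?_
    exact hfc.comp ((continuous_subtype_val.comp continuous_fst).mul (continuous_subtype_val.comp continuous_snd))
  -- integrability on the product: bounded on the compact `closure D_T × C`
  have hΦint : Integrable Φ ((R.μT'.restrict R.DT').prod ν) := by
    have hcomp : IsCompact (closure R.DT' ×ˢ (Set.univ : Set (localTorusAt' W w))) := compT.prod isCompact_univ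
    obtain ⟨M, hM⟩ := hcomp.exists_bound_of_continuousOn hΦc.continuousOn
    refine Integrable.mono' (integrable_const M) hΦc.aestronglyMeasurable ?_
    have hmeas : MeasurableSet {p : torusT' W × localTorusAt' W w | ‖Φ p‖ ≤ M} :=
      (isClosed_le hΦc.norm continuous_const).measurableSet
    rw [Measure.ae_prod_iff_ae_ae hmeas]
    filter_upwards [ae_restrict_mem₀ R.DT'_fund.nullMeasurableSet] with t ht
    exact Filter.Eventually.of_forall fun κ => hM (t, κ) ⟨subset_closure ht, Set.mem_univ _⟩
  -- Fubini
  have hswap : ∫ t in R.DT', ∫ κ : localTorusAt' W w, Φ (t, κ) ∂ν ∂(R.μT') = ∫ κ : localTorusAt' W w, ∫ t in R.DT', Φ (t, κ) ∂(R.μT') ∂ν :=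
    integral_integral_swap hΦint
  have hL : (fun t : torusT' W => R.chi' t * restrictTo W (torusT' W) (kProj (localTorusAt' W w) ν χw f) t) =
      fun t => ∫ κ : localTorusAt' W w, Φ (t, κ) ∂ν := by
    funext t
    simp only [hΦ, restrictTo, kProj]
    rw [← integral_const_mul]
  rw [hL, hswap]
  -- the inner integral: the period of a translate
  have hinner : ∀ κ : localTorusAt' W w, ∫ t in R.DT', Φ (t, κ) ∂(R.μT') =
      conj (χw κ) * ((R.chi' ⟨κ, (Subgroup.mem_inf.1 κ.2).1⟩)⁻¹ * ∫ t in R.DT', R.chi' t * F t ∂(R.μT')) := by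
    intro κ
    set κT : torusT' W := ⟨κ, (Subgroup.mem_inf.1 κ.2).1⟩ with hκT
    have e : (fun t : torusT' W => Φ (t, κ)) = fun t => conj (χw κ) * (R.chi' t * F (t * κT)) := by
      funext t
      simp only [hΦ, hF, restrictTo, Subgroup.coe_mul]
      ring
    rw [e, integral_const_mul, setIntegral_chi'_mul_translate W R hu (F := F) ?_ κT]
    intro γ t
    simp only [hF, restrictTo, Subgroup.coe_mul]
    exact hfinv ⟨((γ : torusT' W) : GA W), Subgroup.mem_subgroupOf.1 γ.2⟩ _
  simp_rw [hinner]
  -- the character matches the weight: `χ(κ)⁻¹ = χ_w(κ)`, and `conj χ_w · χ_w = 1`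
  have hmatch' : ∀ κ : localTorusAt' W w, (R.chi' ⟨κ, (Subgroup.mem_inf.1 κ.2).1⟩)⁻¹ = χw κ := by
    intro κ
    have h := hmatch ⟨κ, (Subgroup.mem_inf.1 κ.2).1⟩ κ.2
    simp only [hχw]
    rw [mul_assoc] at h
    exact (eq_inv_of_mul_eq_one_right h).symm
  have hunit : ∀ κ : localTorusAt' W w, conj (χw κ) * χw κ = 1 := by
    intro κ
    have := hu' κ
    simp only [hχw] at this ⊢
    rw [Complex.conj_mul', this]
    simp
  have e2 : (fun κ : localTorusAt' W w => conj (χw κ) * ((R.chi' ⟨κ, (Subgroup.mem_inf.1 κ.2).1⟩)⁻¹ *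
      ∫ t in R.DT', R.chi' t * F t ∂(R.μT'))) = fun _ : localTorusAt' W w => ∫ t in R.DT', R.chi' t * F t ∂(R.μT') := by
    funext κ
    rw [hmatch' κ, ← mul_assoc, hunit κ, one_mul]
  rw [e2, integral_const, probReal_univ, one_smul]

/-- **C-L4-KTYPE, primed twin — a non-zero `T′`-period forces the `K`-type for the transported torus**: for `f ∈ V` continuous, invariant under the rational
points, with `P_χ(f) ≠ 0` and `χ` matching the weight `(e₊ w, e₋ w)` at `w`, the projection `e_{C,χ_w} f` is a non-zero
member of `V` (stability `hstab` displayed) transforming under the local torus at `w` by that weight: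
`HasKTypeAt W q w (e₊ w) (e₋ w) V`. -/
theorem hasKTypeAt'_of_period_ne_zero (hu : ∀ a, ‖R.chi' a‖ = 1) (hc : Continuous R.chi')
    (compT : IsCompact (closure R.DT'))
    (hχ : ∀ a ∈ localTorusAt' W w, ∀ b ∈ localTorusAt' W w,
      weightAt' W q w g g' 0 (a * b) ^ eP w * weightAt' W q w g g' 1 (a * b) ^ eM w =
        (weightAt' W q w g g' 0 a ^ eP w * weightAt' W q w g g' 1 a ^ eM w) *
          (weightAt' W q w g g' 0 b ^ eP w * weightAt' W q w g g' 1 b ^ eM w))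
    (hχc : Continuous fun κ : localTorusAt' W w => weightAt' W q w g g' 0 κ ^ eP w * weightAt' W q w g g' 1 κ ^ eM w)
    (hu' : ∀ κ : localTorusAt' W w, ‖weightAt' W q w g g' 0 κ ^ eP w * weightAt' W q w g g' 1 κ ^ eM w‖ = 1)
    (hmatch : ChiMatchesAt' W q w g g' (eP w) (eM w) R.chi')
    {V : Submodule ℂ (GA W → ℂ)} {f : GA W → ℂ} (hfc : Continuous f)
    (hfinv : ∀ γ : rationalPoints W, ∀ x, f ((γ : GA W) * x) = f x)
    (hstab : kProj (localTorusAt' W w) ν (fun κ => weightAt' W q w g g' 0 κ ^ eP w * weightAt' W q w g g' 1 κ ^ eM w) f ∈ V)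
    (hP : periodLin W R.μT' R.DT' R.chi' (restrictTo W (torusT' W) f) ≠ 0) :
    HasKTypeAt' W q w g g' (eP w) (eM w) V := by
  refine ⟨kProj (localTorusAt' W w) ν (fun κ => weightAt' W q w g g' 0 κ ^ eP w * weightAt' W q w g g' 1 κ ^ eM w) f, hstab,
    ?_, ?_⟩
  · intro h0
    apply hP
    rw [← periodLin'_kProj_eq W R w q g g' eP eM ν hu hc compT hχc hu' hmatch hfc hfinv, h0]
    have e : restrictTo W (torusT' W) (0 : GA W → ℂ) = 0 := rfl
    rw [e, map_zero]
  · intro x κ hκ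
    exact kProj_apply_mul (localTorusAt' W w) ν hχ (fun a ha => hu' ⟨a, ha⟩) f x hκ

end KTypeOfPeriod'

end Summit.Ventures.HodgeRepro.Tier4.Line4

end
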